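import Summits.QuantumFields.YangMills.Theorems.UnitScaleTiltProp8ChartDefs
import HarnessLib

/-!
# Route `UnitScaleTilt`, crux K1 «MinimiserStabilityRegPr» (stmt-QuantumFields-19200), leaf V2′ `stub_halvingStep` — pillar P3 `ChartPerLevel`:
# **AT LEVEL 0 (THE FROZEN EXTERIOR `Λ₀ = T ∖ □₁`) THE CHART CONSTRAINT IS THE IDENTITY: `chartLog η D A (0, b) = η·A(b)`, `chartQ η D A (0, b) = A(b)`**

Cell `ym3-torus` ∕ fleet seat `ym-ust-19200-p2` g5 (v8 PEN).  [Balaban1985Variational] (156) «Q_j(ηA) = B on Λ′_j, j = 0, 1, …, k» with `Q₀ = id` on the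
level-0 annulus (the fine field itself is prescribed there: (149)–(150), [Balaban1984PropagatorsII] (2.6) «A = B₀ on Λ₀»); the tree's multi-scale `QE D` has the
plain identity at level `0` (`B6SectAOperatorsV1.qFn`: `bondAvgIterLin 0 = id`).  This file checks that the (0.4) chart maps of `Prop8ChartDefs` reproduce exactly
this at every level-0 index, on the domain of the principal logarithm (`‖iηA(b)‖ < log 2`, `B7BlockAvgLog.mlog_exp`): `chartLog_level_zero` (print's reading:
`= η·A(b)`), `chartQ_level_zero` (tree reading: `= A(b)`) — the `j = 0` line of the P2 ↔ P3 normalisation dictionary (`chartLog = (ηLʲ)·chartQ`).  Sorry-free,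
definition-free.  NOT a claim about the mass gap.

References: T. Bałaban, CMP **102** (1985) 277–309 [Balaban1985Variational] ((149)–(150) p.301, (156) p.302); CMP **96** (1984) 223–250 [Balaban1984PropagatorsII]
((2.6) p.224).
-/

noncomputable section

open scoped BigOperators
open NormedSpace

namespace Summit.QuantumFields.YangMills.Theorems.Prop8Chart

open Literature.MathematicalPhysics.QuantumFieldTheory.Balaban1983to89
open ExpMeanLog MatrixLog
open B6SectADomainsV1 (Domains)
open B6SectAOperatorsV1 (BondIdx)

variable {P : Params} {𝔸 : Type*} [NormedRing 𝔸] [NormedAlgebra ℂ 𝔸] [CompleteSpace 𝔸]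

/-- **LEVEL 0 OF THE CHART, PRINT'S READING**: at an index of the frozen exterior (`j = 0`, `b ∈ Λ₀`), `chartLog η D A (0, b) = (1/i)·log e^{iηA(b)} = η·A(b)` whenever
`‖iηA(b)‖ < log 2` (the domain of the principal logarithm) — (156) with `Q₀ = id`. [cite: Balaban1985Variational, (156) p.302; Balaban1984PropagatorsII, (2.6) p.224] -/
theorem chartLog_level_zero (η : ℝ) (D : Domains P) (A : PBond P 0 → 𝔸) (b : PBond P 0) (hb : D.LamBond ((0 : Fin (D.k + 1)) : ℕ) b)
    (hA : ‖(Complex.I * (η : ℂ)) • A b‖ < Real.log 2) :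
    chartLog η D A ⟨⟨0, b⟩, hb⟩ = ((η : ℂ)) • A b := by
  rw [chartLog_apply]
  show (-Complex.I) • mlog (((emlIterU 0 (expCfg η A)) b : 𝔸ˣ) : 𝔸) = ((η : ℂ)) • A b
  rw [emlIterU_zero, coe_expCfg, B7BlockAvgLog.mlog_exp hA, smul_smul]
  congr 1
  rw [← mul_assoc, neg_mul, Complex.I_mul_I, neg_neg, one_mul]

/-- **LEVEL 0 OF THE CHART, TREE READING**: `chartQ η D A (0, b) = A(b)` (`η ≠ 0`, `‖iηA(b)‖ < log 2`) — the identity `Q₀ = id` of `B6SectAOperatorsV1.qFn`.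
[cite: Balaban1985Variational, (156) p.302; Balaban1984PropagatorsII, (2.6) p.224] -/
theorem chartQ_level_zero {η : ℝ} (hη : η ≠ 0) (D : Domains P) (A : PBond P 0 → 𝔸) (b : PBond P 0) (hb : D.LamBond ((0 : Fin (D.k + 1)) : ℕ) b)
    (hA : ‖(Complex.I * (η : ℂ)) • A b‖ < Real.log 2) :
    chartQ η D A ⟨⟨0, b⟩, hb⟩ = A b := by
  rw [chartQ_apply]
  show ((Complex.I * (η : ℂ) * ((P.L : ℂ) ^ (0 : ℕ)))⁻¹) • mlog (((emlIterU 0 (expCfg η A)) b : 𝔸ˣ) : 𝔸) = A b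
  rw [emlIterU_zero, coe_expCfg, B7BlockAvgLog.mlog_exp hA, smul_smul, pow_zero, mul_one]
  have hη' : (Complex.I * (η : ℂ)) ≠ 0 := mul_ne_zero Complex.I_ne_zero (Complex.ofReal_ne_zero.mpr hη)
  rw [inv_mul_cancel₀ hη', one_smul]

omit [CompleteSpace 𝔸] in
/-- The smallness hypothesis in the stub's currency: `‖iηA(b)‖ = |η|·‖A(b)‖`, so `|η|·‖A b‖ < log 2` suffices (e.g. the (152)-regular fields of the cube,
`L⁰η·|A| ≤ 36dL²B₁Mε₀ ≪ log 2`). [cite: Balaban1985Variational, (152) p.301] -/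
theorem norm_I_eta_smul (η : ℝ) (a : 𝔸) : ‖(Complex.I * (η : ℂ)) • a‖ = |η| * ‖a‖ := by
  rw [norm_smul, norm_mul, Complex.norm_I, one_mul, Complex.norm_real, Real.norm_eq_abs]

end Summit.QuantumFields.YangMills.Theorems.Prop8Chart

end
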